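import Summits.NavierStokesRegularity.NavierStokesRegularity.Theorems.FrequencyRigidity.Negative.GalileanKernel
import Summits.NavierStokesRegularity.NavierStokesRegularity.Theorems.FrequencyRigidity.Negative.Clauses

/-!
# `FrequencyRigidity` (crux `stmt-NavierStokesRegularity-2955`): the witness class is invariant under
# Type-I Galilean wobbles; the kernel hypotheses of Stub 2b (`stub_kernelPairing`, line
# `two-ended-pinning`) are inhabited WITH transport — negative-side support (refuter, drefute g2)

Built on the kernel covariance of `Negative/GalileanKernel.lean` and the clause bundles of
`Negative/Clauses.lean` (`TypeIBound`, `KernelClauses`, `Comparable`, `FreqClause`).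
1. Transport witness (`kernelHyps_satisfiable_with_transport`): the parasitic Type-I drift
   `v(t,x) = −(b/√(−t))e` on `ℝ³` (jointly smooth, divergence free, `‖v‖ = |b|‖e‖/√(−t)`; KNSS's
   "parasitic solution" with pressure `−b′(t)·x`) and its translating kernel
   `K(t,x) = Γ_{ν(−t)}(x − 2b√(−t)e)` satisfy ALL kernel hypotheses of Stub 2b (adapted on `(−∞,0)` at
   `(0,0)`, two-sided Gaussian-comparable) with `DK·v ≠ 0` — whereas every inhabitant used before
   (zero flow in `TwoEndedPinningStubs.hyps_2b_satisfiable`, rigid rotation, the self-similar swirl)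
   has `DK·v ≡ 0`, the term whose sign Stub 2b's conclusion `d/dt ∫φK = ∫(∂ₜφ + Dφ·v − νΔφ)K`
   depends on.  (On this instance the conclusion was checked by hand and numerically for `φ = sin x₁`,
   `∫φK = −e^{νt} sin(2b√(−t))`; the opposite-sign kernel fails it — refuter notes.)
2. Witness-class invariance (the crux's design claim "(i) invariant under the generalized Galilei
   wobble `v(x − B(t),t) + B′(t)` — to which `H` and `Λ` are blind", kernel-checked):
   `isClassicalNSSolutionOn_wobble` (classical NS on `(−∞,0)` is covariant: `ũ = v(t,x−B)+B′`,
   `q̃ = q(t,x−B) − ⟪B″,x⟫`; the `−Dv·B′` of `∂ₜũ` cancels the `+Dv·B′` of `(ũ·∇)ũ`, `B″` cancels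
   `−∇⟪B″,x⟫`), `typeIBound_wobble` (`C ↦ C + C_B`), `curl_wobbleDrift` / `adaptedEnstrophy_wobble` /
   `freqClause_wobble` (`H̃ = H`, `Λ̃ = Λ` identically), `norm_le_of_typeI_velocity` (a Type-I wobble
   vanishing at the pole has `‖B(t)‖ ≤ 2C_B√(−t)`, FTC), and `witness_wobble`: the body of
   `¬FrequencyRigidity` is invariant under smooth wobbles with Type-I velocity vanishing at the pole.
   So a prover may fix the Galilean gauge of a putative witness at will (centre the kernel, remove the
   parasitic part `b(t)` on a window); no counterexample can come from wobbling a non-witness.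
No `¬`-theorem of a Theses decl is claimed; nothing here asserts a route statement positively.

## References

* G. Koch, N. Nadirashvili, G. Seregin, V. Šverák, Acta Math. 203 (2009) 83–105
  (arXiv:0709.3599), p. 3 (parasitic solutions), §3 Lemma 3.1 / Remark 3.1. [KochNadirashviliSereginSverak2009]
-/

noncomputable section

set_option linter.dupNamespace false

namespace Summit.NavierStokesRegularity.NavierStokesRegularity.Theorems.FrequencyRigidity.Negative

open Literature.Analysis.FluidPDE Literature.Analysis.UnboundedOperators
open MeasureTheory Set Filter Topology Function
open scoped Laplacian InnerProductSpace RealInnerProductSpace ContDiff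

/-! ### Non-vacuity WITH transport of the kernel hypotheses of the crux / of Stub 2b (`ℝ³`) -/

section TransportWitness

/-- The parasitic drift as a space–time field on `ℝ³`: `v(t, x) = −(b/√(−t)) e`. -/
def driftField (b : ℝ) (e : E3) (t : ℝ) (_x : E3) : E3 := parasiticDrift 0 b e t

/-- Its translating kernel `K(t, x) = Γ_{ν(−t)}(x − 2b√(−t) e)`. -/
def driftKernel (ν b : ℝ) (e : E3) : ℝ → E3 → ℝ :=
  wobbleKernel (backwardHeatKernel ν 0 (0 : E3)) (parabolicShift 0 b e)

/-- The drift field is jointly smooth on `(−∞,0) × ℝ³`. -/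
theorem isSmoothSpaceTimeOn_driftField (b : ℝ) (e : E3) : IsSmoothSpaceTimeOn (Iio 0) (driftField b e) := by
  have h1 : ContDiffOn ℝ ∞ (fun p : ℝ × E3 => -(b / Real.sqrt (0 - p.1))) (Iio 0 ×ˢ univ) :=
    (contDiffOn_const.div ((contDiffOn_const.sub contDiffOn_fst).sqrt fun p hp =>
      (sub_pos.2 (show p.1 < 0 from hp.1)).ne') fun p hp =>
        (Real.sqrt_pos.2 (sub_pos.2 (show p.1 < 0 from hp.1))).ne').neg
  exact h1.smul contDiffOn_const

/-- The drift field is divergence free (it is constant in `x`). -/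
theorem isDivFree_driftField (b : ℝ) (e : E3) (t : ℝ) : VectorCalculus.IsDivFree (driftField b e t) := by
  intro x
  show VectorCalculus.divergence (fun _ : E3 => parasiticDrift 0 b e t) x = 0
  rw [VectorCalculus.divergence, fderiv_fun_const, Pi.zero_apply]
  simp

/-- The drift field is time-Type-I with constant `|b|‖e‖`. -/
theorem hasTypeITimeDecay_driftField (b : ℝ) (e : E3) : HasTypeITimeDecay (|b| * ‖e‖) (driftField b e) := by
  intro t ht x
  have hs : 0 < Real.sqrt (-t) := Real.sqrt_pos.2 (by linarith)
  show ‖(-(b / Real.sqrt (0 - t))) • e‖ ≤ |b| * ‖e‖ / Real.sqrt (-t)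
  rw [zero_sub, norm_smul, norm_neg, norm_div, Real.norm_eq_abs, Real.norm_eq_abs, abs_of_pos hs]
  exact le_of_eq (by ring)

/-- The drift kernel is adapted to the drift field and Gaussian-comparable at the pole `(0,0)`. -/
theorem driftKernel_adapted {ν : ℝ} (hν : 0 < ν) (b : ℝ) (e : E3) :
    IsAdaptedBackwardKernel ν (driftField b e) (Iio 0) 0 0 (driftKernel ν b e) ∧
      IsGaussianComparable (driftKernel ν b e) (Iio 0) 0 0 :=
  ⟨isAdaptedBackwardKernel_parasiticDrift hν 0 b 0 e, isGaussianComparable_parasiticDrift hν 0 b 0 e⟩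

/-- **Transport is exercised**: `DK·v ≠ 0` (at `t = −1`, `x = 0`) as soon as `b ≠ 0`, `e ≠ 0`. -/
theorem driftKernel_transport_ne_zero {ν : ℝ} (hν : 0 < ν) {b : ℝ} (hb : b ≠ 0) {e : E3} (he : e ≠ 0) :
    fderiv ℝ (driftKernel ν b e (-1)) 0 (driftField b e (-1) 0) ≠ 0 := by
  have hD : fderiv ℝ (driftKernel ν b e (-1)) 0 =
      fderiv ℝ (backwardHeatKernel ν 0 (0 : E3) (-1)) (0 - parabolicShift 0 b e (-1)) := by
    show fderiv ℝ (fun z => backwardHeatKernel ν 0 (0 : E3) (-1) (z - parabolicShift 0 b e (-1))) 0 = _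
    rw [fderiv_comp_sub]
  rw [hD, fderiv_backwardHeatKernel_apply]
  have hB : parabolicShift 0 b e (-1) = (2 * b) • e := by simp [parabolicShift]
  have hv : driftField b e (-1) 0 = (-b) • e := by simp [driftField, parasiticDrift]
  rw [hB, hv, zero_sub ((2 * b) • e), inner_neg_left, inner_smul_left, inner_smul_right,
    conj_trivial, real_inner_self_eq_norm_sq]
  have hK : 0 < heatKernel (ν * (0 - (-1))) (-((2 * b) • e)) := heatKernel_pos (by simpa using hν) _
  have hden : (2 * (ν * (0 - (-1 : ℝ)))) ≠ 0 := by norm_num [hν.ne']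
  have he2 : 0 < ‖e‖ ^ 2 := by positivity
  have hb2 : 0 < b ^ 2 := by positivity
  have h1 : heatKernel (ν * (0 - (-1))) (-((2 * b) • e)) / (2 * (ν * (0 - (-1)))) ≠ 0 :=
    div_ne_zero hK.ne' hden
  have h2 : -(2 * b * (-b * ‖e‖ ^ 2)) ≠ 0 := by
    have : 0 < -(2 * b * (-b * ‖e‖ ^ 2)) := by nlinarith
    exact this.ne'
  exact mul_ne_zero (neg_ne_zero.2 h1) h2

/-- **Non-vacuity with transport** of the hypotheses of Stub 2b (`stub_kernelPairing`): the drift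
field (`b = 1`, `e = e₃`) is jointly smooth, divergence-free and Type-I, the drift kernel is adapted
to it and Gaussian-comparable, and `DK·v ≠ 0` at `(t, x) = (−1, 0)`. -/
theorem kernelHyps_satisfiable_with_transport :
    ∃ (ν C : ℝ) (v : ℝ → E3 → E3) (K : ℝ → E3 → ℝ),
      IsSmoothSpaceTimeOn (Iio 0) v ∧ (∀ t ∈ Iio (0:ℝ), VectorCalculus.IsDivFree (v t)) ∧
      HasTypeITimeDecay C v ∧ IsAdaptedBackwardKernel ν v (Iio 0) 0 0 K ∧
      IsGaussianComparable K (Iio 0) 0 0 ∧ ∃ t ∈ Iio (0:ℝ), ∃ x, fderiv ℝ (K t) x (v t x) ≠ 0 := by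
  have he : (e₃ : E3) ≠ 0 := fun h => by
    have := congrArg (fun v : E3 => v 2) h
    simp [e₃] at this
  exact ⟨1, |1| * ‖(e₃ : E3)‖, driftField 1 e₃, driftKernel 1 1 e₃, isSmoothSpaceTimeOn_driftField 1 e₃,
    fun t _ => isDivFree_driftField 1 e₃ t, hasTypeITimeDecay_driftField 1 e₃,
    (driftKernel_adapted one_pos 1 e₃).1, (driftKernel_adapted one_pos 1 e₃).2,
    -1, by norm_num, 0, driftKernel_transport_ne_zero one_pos one_ne_zero he⟩

end TransportWitness

/-! ### The witness class of the crux is invariant under Type-I Galilean wobbles (`ℝ³`) -/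

section WitnessWobble

/-- The wobbled pressure `q̃(t, x) = q(t, x − B(t)) − ⟪B″(t), x⟫`. -/
def wobblePressure (q : ℝ → E3 → ℝ) (B : ℝ → E3) (t : ℝ) (x : E3) : ℝ :=
  q t (x - B t) - ⟪deriv (deriv B) t, x⟫

variable {ν C Λ₀ : ℝ} {v : ℝ → E3 → E3} {q : ℝ → E3 → ℝ} {K : ℝ → E3 → ℝ} {B : ℝ → E3}

/-- Translation invariance of the vector Laplacian plus a constant. -/
theorem laplacian_wobble_slice {w : E3 → E3} (hw : ContDiff ℝ 2 w) (a c x : E3) :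
    (Δ (fun z => w (z - a) + c)) x = (Δ w) (x - a) := by
  have h1 : ContDiffAt ℝ 2 (fun z => w (z - a)) x := (hw.comp (contDiff_id.sub contDiff_const)).contDiffAt
  have h2 : ContDiffAt ℝ 2 (fun _ : E3 => c) x := contDiffAt_const
  have h := h1.laplacian_add h2
  have hfg : ((fun z => w (z - a)) + fun _ : E3 => c) = fun z => w (z - a) + c := rfl
  rw [hfg] at h
  rw [h, InnerProductSpace.laplacian_const, Pi.zero_apply, add_zero,
    InnerProductSpace.laplacian_eq_iteratedFDeriv_stdOrthonormalBasis,
    InnerProductSpace.laplacian_eq_iteratedFDeriv_stdOrthonormalBasis]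
  simp only [iteratedFDeriv_comp_sub]

/-- `D(ũ(t))(x) = D(v(t))(x − B(t))` (unconditionally, junk values included). -/
theorem fderiv_wobbleDrift (v : ℝ → E3 → E3) (B B' : ℝ → E3) (t : ℝ) (x : E3) :
    fderiv ℝ (wobbleDrift v B B' t) x = fderiv ℝ (v t) (x - B t) := by
  show fderiv ℝ (fun z => v t (z - B t) + B' t) x = _
  rw [fderiv_add_const, fderiv_comp_sub]

/-- The vorticity is blind to the wobble: `curl ũ(t) (x) = curl v(t) (x − B(t))`. -/
theorem curl_wobbleDrift (v : ℝ → E3 → E3) (B B' : ℝ → E3) (t : ℝ) (x : E3) :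
    curl (wobbleDrift v B B' t) x = curl (v t) (x - B t) := by
  simp only [curl, fderiv_wobbleDrift]

/-- The adapted enstrophy is blind to the wobble: `H̃ = H` as functions of time. -/
theorem adaptedEnstrophy_wobble (v : ℝ → E3 → E3) (K : ℝ → E3 → ℝ) (B B' : ℝ → E3) :
    (fun t => ∫ x, ‖curl (wobbleDrift v B B' t) x‖ ^ 2 * wobbleKernel K B t x) =
      fun t => ∫ x, ‖curl (v t) x‖ ^ 2 * K t x := by
  funext t
  simp only [curl_wobbleDrift, wobbleKernel]
  exact integral_sub_right_eq_self (fun y => ‖curl (v t) y‖ ^ 2 * K t y) (B t)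

/-- The frequency clause is blind to the wobble. -/
theorem freqClause_wobble (B B' : ℝ → E3) (hF : FreqClause v K Λ₀) :
    FreqClause (wobbleDrift v B B') (wobbleKernel K B) Λ₀ := by
  intro H Λ hH hΛ
  rw [adaptedEnstrophy_wobble] at hH
  exact hF H Λ hH hΛ

/-- The Type-I bound survives a Type-I wobble. -/
theorem typeIBound_wobble {C_B : ℝ} (B : ℝ → E3) {B' : ℝ → E3}
    (hB' : ∀ t < 0, ‖B' t‖ ≤ C_B / Real.sqrt (-t)) (hTI : TypeIBound C v) :
    TypeIBound (C + C_B) (wobbleDrift v B B') := by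
  intro t ht x
  calc ‖wobbleDrift v B B' t x‖ ≤ ‖v t (x - B t)‖ + ‖B' t‖ := norm_add_le _ _
    _ ≤ C / Real.sqrt (-t) + C_B / Real.sqrt (-t) := add_le_add (hTI t ht _) (hB' t ht)
    _ = (C + C_B) / Real.sqrt (-t) := by ring

/-- **Classical Navier–Stokes flows are covariant under smooth Galilean wobbles**:
`ũ = v(t, x − B) + B′`, `q̃ = q(t, x − B) − ⟪B″, x⟫`. -/
theorem isClassicalNSSolutionOn_wobble (hNS : IsClassicalNSSolutionOn (Iio 0) ν 0 v q)
    (hB : ContDiffOn ℝ ∞ B (Iio 0)) :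
    IsClassicalNSSolutionOn (Iio 0) ν 0 (wobbleDrift v B (deriv B)) (wobblePressure q B) := by
  have hB1 : ContDiffOn ℝ ∞ (deriv B) (Iio 0) := hB.deriv_of_isOpen isOpen_Iio le_rfl
  have hB2 : ContDiffOn ℝ ∞ (deriv (deriv B)) (Iio 0) := hB1.deriv_of_isOpen isOpen_Iio le_rfl
  have hmap : ContDiffOn ℝ ∞ (fun p : ℝ × E3 => (p.1, p.2 - B p.1)) (Iio 0 ×ˢ univ) :=
    contDiffOn_fst.prodMk (contDiffOn_snd.sub (hB.comp contDiffOn_fst fun p hp => hp.1))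
  have hmaps : MapsTo (fun p : ℝ × E3 => (p.1, p.2 - B p.1)) (Iio 0 ×ˢ univ) (Iio 0 ×ˢ univ) :=
    fun p hp => ⟨hp.1, mem_univ _⟩
  refine ⟨?_, ?_, ?_, ?_⟩
  · -- joint smoothness of the velocity
    exact ((hNS.smooth_velocity.comp hmap hmaps).add (hB1.comp contDiffOn_fst fun p hp => hp.1)).congr
      fun p _ => rfl
  · -- joint smoothness of the pressure
    refine ((hNS.smooth_pressure.comp hmap hmaps).sub
      ((hB2.comp contDiffOn_fst fun p hp => hp.1).inner ℝ contDiffOn_snd)).congr fun p _ => ?_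
    rfl
  · -- momentum
    intro t ht x
    have ht' : Iio (0:ℝ) ∈ 𝓝 t := Iio_mem_nhds ht
    set y : E3 := x - B t with hy
    have hv1 : ContDiffOn ℝ 1 (uncurry v) (Iio 0 ×ˢ univ) := hNS.smooth_velocity.of_le (by norm_cast)
    set L : ℝ × E3 →L[ℝ] E3 := fderiv ℝ (uncurry v) (t, y) with hL
    have hvd : HasFDerivAt (uncurry v) L (t, y) := hasFDerivAt_uncurry_of_contDiffOn hv1 ht' y
    -- derivatives of the path
    have hBd : HasDerivAt B (deriv B t) t :=
      ((hB.differentiableOn (by simp)).differentiableAt ht').hasDerivAt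
    have hB'd : HasDerivAt (deriv B) (deriv (deriv B) t) t :=
      ((hB1.differentiableOn (by simp)).differentiableAt ht').hasDerivAt
    -- time derivative of the wobbled velocity
    have hc : HasDerivAt (fun s => x - B s) (-deriv B t) t := by simpa using hBd.const_sub x
    have htime : HasDerivAt (fun s => wobbleDrift v B (deriv B) s x)
        ((L (1, 0) + L (0, -deriv B t)) + deriv (deriv B) t) t :=
      (hasDerivAt_along' hvd hc rfl).add hB'd
    have hdt : timeDerivWithin (Iio 0) (wobbleDrift v B (deriv B)) t x =
        (L (1, 0) + L (0, -deriv B t)) + deriv (deriv B) t := by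
      rw [timeDerivWithin_apply, derivWithin_of_mem_nhds ht']
      exact htime.deriv
    have hvt : timeDerivWithin (Iio 0) v t y = L (1, 0) := timeDerivWithin_eq_fderiv_of_contDiffOn hv1 ht' y
    have hvx : ∀ h : E3, fderiv ℝ (v t) y h = L (0, h) := fun h => by
      rw [(hasFDerivAt_slice_of_contDiffOn hv1 ht' y).fderiv]; rfl
    -- convective term
    have hconv : convect (wobbleDrift v B (deriv B) t) (wobbleDrift v B (deriv B) t) x =
        convect (v t) (v t) y + fderiv ℝ (v t) y (deriv B t) := by
      rw [convect_apply, convect_apply, fderiv_wobbleDrift, ← map_add]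
      rfl
    -- Laplacian
    have hΔ : (Δ (wobbleDrift v B (deriv B) t)) x = (Δ (v t)) y :=
      laplacian_wobble_slice ((hNS.contDiff_velocity ht).of_le (by norm_cast)) (B t) (deriv B t) x
    -- pressure gradient
    have hq1 : ContDiff ℝ 1 (q t) := (hNS.contDiff_pressure ht).of_le (by norm_cast)
    have hgrad : gradient (wobblePressure q B t) x = gradient (q t) y - deriv (deriv B) t := by
      have h1 : HasFDerivAt (fun z : E3 => q t (z - B t))
          (InnerProductSpace.toDual ℝ E3 (gradient (q t) y)) x := by
        have hg : HasGradientAt (q t) (gradient (q t) y) y :=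
          (hq1.differentiable one_ne_zero y).hasGradientAt
        rw [hasGradientAt_iff_hasFDerivAt] at hg
        exact (hasFDerivAt_comp_sub (B t)).2 hg
      have h2 : HasFDerivAt (fun z : E3 => ⟪deriv (deriv B) t, z⟫)
          (InnerProductSpace.toDual ℝ E3 (deriv (deriv B) t)) x :=
        (InnerProductSpace.toDual ℝ E3 (deriv (deriv B) t)).hasFDerivAt
      have h3 : HasGradientAt (wobblePressure q B t) (gradient (q t) y - deriv (deriv B) t) x := by
        rw [hasGradientAt_iff_hasFDerivAt, map_sub]
        exact h1.sub h2
      exact h3.gradient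
    have h0 := hNS.momentum t ht y
    simp only [Pi.zero_apply, add_zero] at h0 ⊢
    rw [hdt, hconv, hΔ, hgrad, ← hvt, hvx]
    have hneg : L (0, -deriv B t) = -L (0, deriv B t) := by rw [← map_neg, Prod.neg_mk, neg_zero]
    rw [hneg]
    -- `h0 : ∂ₜv + (v·∇)v = νΔv − ∇q` at `(t, y)`
    have : timeDerivWithin (Iio 0) v t y + -L (0, deriv B t) + deriv (deriv B) t +
        (convect (v t) (v t) y + L (0, deriv B t)) =
        (timeDerivWithin (Iio 0) v t y + convect (v t) (v t) y) + deriv (deriv B) t := by abel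
    rw [this, h0]
    abel
  · -- incompressibility
    intro t ht x
    show VectorCalculus.divergence (wobbleDrift v B (deriv B) t) x = 0
    rw [VectorCalculus.divergence, fderiv_wobbleDrift]
    exact hNS.divFree t ht (x - B t)

/-- **A Type-I wobble lives on the parabolic scale**: if `B` is smooth on `(−∞,0)` with
`‖B′(t)‖ ≤ C_B/√(−t)` and `B(t) → 0` as `t ↑ 0`, then `‖B(t)‖ ≤ 2C_B√(−t)` (FTC on `[t, s]`,
`∫ₜˢ C_B/√(−r) dr = 2C_B(√(−t) − √(−s))`, and `s ↑ 0`). -/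
theorem norm_le_of_typeI_velocity {C_B : ℝ} (hB : ContDiffOn ℝ ∞ B (Iio 0))
    (hB' : ∀ t < 0, ‖deriv B t‖ ≤ C_B / Real.sqrt (-t)) (hB0 : Tendsto B (𝓝[<] 0) (𝓝 0))
    {t : ℝ} (ht : t < 0) : ‖B t‖ ≤ 2 * C_B * Real.sqrt (-t) := by
  have hB1 : ContDiffOn ℝ ∞ (deriv B) (Iio 0) := hB.deriv_of_isOpen isOpen_Iio le_rfl
  have hBd : ∀ r < 0, HasDerivAt B (deriv B r) r := fun r hr =>
    ((hB.differentiableOn (by simp)).differentiableAt (Iio_mem_nhds hr)).hasDerivAt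
  -- the bound on `(t, s)`, `t < s < 0`
  have hseg : ∀ s, t < s → s < 0 → ‖B t‖ ≤ 2 * C_B * Real.sqrt (-t) + ‖B s‖ := by
    intro s hts hs0
    have hts' : t ≤ s := hts.le
    have hsub : uIcc t s ⊆ Iio 0 := fun r hr => by
      rw [uIcc_of_le hts'] at hr
      exact lt_of_le_of_lt hr.2 hs0
    -- FTC for `B`
    have hFTC : ∫ r in t..s, deriv B r = B s - B t :=
      intervalIntegral.integral_eq_sub_of_hasDerivAt (fun r hr => hBd r (hsub hr))
        ((hB1.continuousOn.mono hsub).intervalIntegrable)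
    -- FTC for the majorant `r ↦ −2 C_B √(−r)`
    have hprim : ∀ r ∈ uIcc t s, HasDerivAt (fun r => -(2 * C_B) * Real.sqrt (-r))
        (C_B / Real.sqrt (-r)) r := by
      intro r hr
      have hr0 : 0 < -r := neg_pos.2 (hsub hr)
      have h1 : HasDerivAt (fun r => Real.sqrt (-r)) ((-1) / (2 * Real.sqrt (-r))) r :=
        (hasDerivAt_neg r).sqrt hr0.ne'
      refine (h1.const_mul (-(2 * C_B))).congr_deriv ?_
      have : Real.sqrt (-r) ≠ 0 := (Real.sqrt_pos.2 hr0).ne'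
      field_simp
    have hmaj : ∫ r in t..s, C_B / Real.sqrt (-r) =
        -(2 * C_B) * Real.sqrt (-s) - -(2 * C_B) * Real.sqrt (-t) := by
      refine intervalIntegral.integral_eq_sub_of_hasDerivAt hprim (ContinuousOn.intervalIntegrable ?_)
      exact continuousOn_const.div (continuous_neg.continuousOn.sqrt) fun r hr =>
        (Real.sqrt_pos.2 (neg_pos.2 (hsub hr))).ne'
    have hle : ‖∫ r in t..s, deriv B r‖ ≤ ∫ r in t..s, C_B / Real.sqrt (-r) :=
      intervalIntegral.norm_integral_le_of_norm_le hts'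
        (Eventually.of_forall fun r hr => hB' r (lt_of_le_of_lt hr.2 hs0))
        (ContinuousOn.intervalIntegrable (continuousOn_const.div
          (continuous_neg.continuousOn.sqrt) fun r hr => (Real.sqrt_pos.2 (neg_pos.2 (hsub hr))).ne'))
    have hCB : 0 ≤ C_B := by
      have h := hB' t ht
      have hs : 0 < Real.sqrt (-t) := Real.sqrt_pos.2 (by linarith)
      rw [le_div_iff₀ hs] at h
      nlinarith [norm_nonneg (deriv B t)]
    have hss : 0 ≤ Real.sqrt (-s) := Real.sqrt_nonneg _
    calc ‖B t‖ = ‖(B s - B t) - B s‖ := by rw [sub_sub_cancel_left, norm_neg]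
      _ ≤ ‖B s - B t‖ + ‖B s‖ := norm_sub_le _ _
      _ = ‖∫ r in t..s, deriv B r‖ + ‖B s‖ := by rw [hFTC]
      _ ≤ (∫ r in t..s, C_B / Real.sqrt (-r)) + ‖B s‖ := by gcongr
      _ = 2 * C_B * Real.sqrt (-t) - 2 * C_B * Real.sqrt (-s) + ‖B s‖ := by rw [hmaj]; ring
      _ ≤ 2 * C_B * Real.sqrt (-t) + ‖B s‖ := by nlinarith
  -- let `s ↑ 0`
  have hlim : Tendsto (fun s => 2 * C_B * Real.sqrt (-t) + ‖B s‖) (𝓝[<] 0)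
      (𝓝 (2 * C_B * Real.sqrt (-t) + ‖(0:E3)‖)) :=
    tendsto_const_nhds.add (hB0.norm)
  rw [norm_zero, add_zero] at hlim
  refine ge_of_tendsto hlim ?_
  have hev : ∀ᶠ s in 𝓝[<] (0:ℝ), t < s := by
    have : Ioo t 0 ∈ 𝓝[<] (0:ℝ) := Ioo_mem_nhdsLT ht
    filter_upwards [this] with s hs using hs.1
  filter_upwards [hev, self_mem_nhdsWithin] with s hts hs0
  exact hseg s hts hs0

/-- **The witness class of the crux is invariant under Type-I Galilean wobbles.**  If
`(ν, C, Λ₀, v, q, K)` satisfies the body of `¬FrequencyRigidity` (classical NS on `(−∞,0)`, global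
Type-I bound, the five kernel clauses at `(0,0)`, two-sided Gaussian comparability, positive adapted
enstrophy with constant frequency `Λ₀`) and `B` is a smooth path on `(−∞,0)` with Type-I velocity
`‖B′(t)‖ ≤ C_B/√(−t)` vanishing at the pole (hence on the parabolic scale `‖B(t)‖ ≤ 2C_B√(−t)`,
`norm_le_of_typeI_velocity`), then the wobbled sextuple `(ν, C + C_B, Λ₀, ũ, q̃, K̃)` satisfies it too — `H̃ = H`, `Λ̃ = Λ`
identically.  (The crux's design claim (i), kernel-checked; a prover may therefore fix the Galilean
gauge of a putative witness, e.g. centre its kernel, without loss.) -/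
theorem witness_wobble {C_B : ℝ} (hν : 0 < ν) (hNS : IsClassicalNSSolutionOn (Iio 0) ν 0 v q)
    (hTI : TypeIBound C v) (hK : KernelClauses ν v K) (hCmp : Comparable K) (hF : FreqClause v K Λ₀)
    (hB : ContDiffOn ℝ ∞ B (Iio 0)) (hB' : ∀ t < 0, ‖deriv B t‖ ≤ C_B / Real.sqrt (-t))
    (hB0 : Tendsto B (𝓝[<] 0) (𝓝 0)) :
    0 < ν ∧ IsClassicalNSSolutionOn (Iio 0) ν 0 (wobbleDrift v B (deriv B)) (wobblePressure q B) ∧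
      TypeIBound (C + C_B) (wobbleDrift v B (deriv B)) ∧
      KernelClauses ν (wobbleDrift v B (deriv B)) (wobbleKernel K B) ∧
      Comparable (wobbleKernel K B) ∧ FreqClause (wobbleDrift v B (deriv B)) (wobbleKernel K B) Λ₀ := by
  have hKa : IsAdaptedBackwardKernel ν v (Iio 0) 0 0 K := isAdaptedBackwardKernel_iff.2 hK
  have hBd : ∀ t < 0, HasDerivAt B (deriv B t) t := fun t ht =>
    ((hB.differentiableOn (by simp)).differentiableAt (Iio_mem_nhds ht)).hasDerivAt
  have hKw := isAdaptedBackwardKernel_wobble hKa (hB.of_le (by norm_cast)) hBd hB0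
  have hBsq : ∀ t < 0, ‖B t‖ ^ 2 ≤ 4 * C_B ^ 2 * (0 - t) := fun t ht => by
    have h := norm_le_of_typeI_velocity hB hB' hB0 ht
    have h0 : 0 ≤ 2 * C_B * Real.sqrt (-t) := (norm_nonneg _).trans h
    have h2 := pow_le_pow_left₀ (norm_nonneg _) h 2
    rw [mul_pow, Real.sq_sqrt (by linarith)] at h2
    linarith [h2]
  have hCw : IsGaussianComparable (wobbleKernel K B) (Iio 0) 0 0 :=
    isGaussianComparable_wobble (isGaussianComparable_iff_fin_three.2 hCmp) hBsq
  exact ⟨hν, isClassicalNSSolutionOn_wobble hNS hB, typeIBound_wobble B hB' hTI,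
    isAdaptedBackwardKernel_iff.1 hKw, isGaussianComparable_iff_fin_three.1 hCw, freqClause_wobble B _ hF⟩

end WitnessWobble

end Summit.NavierStokesRegularity.NavierStokesRegularity.Theorems.FrequencyRigidity.Negative

end
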